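import Mathlib
import HarnessLib
import Summits.Langlands.Statement
import Summits.Langlands.Langlands.Theses.AuxiliaryLevelSplit
import Summits.Langlands.Langlands.Theses.PrimeSwitchSplit
import Literature.NumberTheory.Automorphic.JacquetLanglandsParts

/-!
# TransientLevelSplit — lens-3 gen 24 node of the cell `decomp-langlands` (planner-decomp-langlands-lens-3-g24-0, 2026-08-31)

TARGET (by name): `Summit.Langlands.Langlands.Theses.AuxiliaryLevelSplit.LevelFiniteness` = stmt-Langlands-27042 (crux rank 3, the
DECLARED RESIDUAL of route-Langlands-AuxiliaryLevelSplit = this lineage's gen-20 child of `DepthPrimeSplit.FernSpread` 25024; OPEN ·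
WEAKER · leaf IDEA-NEEDED; never cut).

U(ρ): for irreducible pinned-geometric `ρ : Γ_K → GL_n(ℚ̄_ℓ)`:  H∞(ρ) «LEVEL-FREE pro-automorphy: for every radius r > 0 SOME L-algebraic
cuspidal π_r is r-close to ρ at ALMOST ALL places (exceptional set E_r free to grow with the depth)» ⟹ C(ρ) «pro-automorphy of BOUNDED
level: ONE finite S serves every radius at EVERY v ∉ S».

THE ONE CERTIFIED TRANSLATION (lens-3's single allowed EQUIV, kernel `levelFiniteness_iff_pieces`, modulo NOTHING):
    U  ⟺  PlacewiseLevelControl ∧ UniformLevelControl,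
through the NEW intermediate language C_pt(ρ) «PLACEWISE bounded-level pro-automorphy: outside ONE finite set S, EVERY place v is,
for every radius r > 0, a good place of SOME r-approximant — an L-algebraic cuspidal π that is r-close to ρ AT v and at almost all
other places».  The ladder of depths is  C ⟹ C_pt ⟹ H∞  (kernel: `placewise_of_pro`, `levelFree_of_placewise` — the latter uses only
that a number field has infinitely many finite places, `Literature.NumberTheory.Automorphic.infinite_heightOneSpectrum`), and U = (H∞ ⟹ C)
splits at C_pt:
  • U₁ = `PlacewiseLevelControl` : H∞ ⟹ C_pt — «auxiliary level is TRANSIENT at each fixed generic place».  ATTACKABLE by a mechanism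
    not used before in the cell (TRANSIENCE OF AUXILIARY LEVEL, §4 docstrings): given Galois avatars with full local–global compatibility
    at v for the approximants (the direction-(A) cores W⁺ 17415 / L∤R 18084 of the host lineage) and FROBENIUS GENERICITY of ρ at v (no two
    eigenvalues of ρ(Frob_v) in ratio q_v — S-implied in print: the local component of a cuspidal π is generic (Shalika) and an unramified
    generic representation of GL_n is a full irreducible induced one, Bernstein–Zelevinsky / Zelevinsky 9.7, i.e. α_i ≠ q_v^{±1} α_j), every
    sufficiently deep a.e.-approximant π_m is AUTOMATICALLY unramified at v with Satake polynomial ℓ-adically close to charpoly ρ(Frob_v):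
    (i) Čebotarev + continuity upgrade the a.e. Hecke congruence to tr ρ_{π_m} ≡ tr ρ (mod ℓ^{m−c}) on all of Γ_K; (ii) on inertia at v
    the characteristic polynomial of ρ_{π_m}(τ) is ≡ (X−1)^n, so every (root-of-unity) eigenvalue ζ satisfies v_ℓ(ζ−1) ≥ (m−c′)/n, which for
    m > n/(ℓ−1) + c′ forces ζ = 1 (ζ ≠ 1 of ℓ-power order has v_ℓ(ζ−1) ≤ 1/(ℓ−1); other orders give units): the Weil–Deligne type of π_{m,v} is
    (unramified r_m, N_m); (iii) N_m ≠ 0 forces two Frobenius eigenvalues of ρ_{π_m}(Frob_v) in ratio q_v, and these converge to eigenvalues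
    of ρ(Frob_v) — so N_m ≠ 0 for infinitely many m contradicts genericity of ρ at v.  The depth-m level-raising congruence
    α_i ≡ q_v α_j (mod ℓ^m) at a FIXED generic place cannot persist as m → ∞: the place v leaves the auxiliary level.
  • U₂ = `UniformLevelControl` : C_pt ⟹ C — «placewise transience ⟹ ONE uniform finite level»: the genuine level-LOWERING content
    (declared residual, IDEA-NEEDED): for each depth m the depth-m level-raising places {v : α_i ≡ q_v α_j mod ℓ^m for some i ≠ j} have
    positive density (Čebotarev in ρ mod ℓ^m ⊕ cyclotomic), so the approximants handed over by C_pt may carry auxiliary level wandering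
    through an infinite set; removing it SIMULTANEOUSLY at all depths is Mazur's principle / Ihara-lemma territory modulo ℓ^m
    (Khare 2004 Prop. 1; Dummigan; Camporino–Pacetti Cor. 1.1; Boyer 2019; CHT Ihara) — exactly what transience cannot do.
Both pieces are IMPLIED BY THE TARGET (`placewise_of_levelFiniteness`, `uniform_of_levelFiniteness`), hence by FERN
(`…_of_fernSpread`), by B_w = 17414 (`…_of_weak`) and by the summit (`…_of_langlands`): no EXCESS.  U₂ ⟺ U only modulo U₁ (open):
two OPEN pieces.  The join `closes` is composition (trivial seam — informational; the content is in the two pieces).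

| piece | decl | vs U | status | leaf |
|---|---|---|---|---|
| U₁ | `PlacewiseLevelControl` (crux r2, deciding) | WEAKER (kernel `placewise_of_levelFiniteness`; not known to imply U: the depth-m level-raising places have positive density, so placewise transience bounds no uniform level — KLR p.2, Diamond–Taylor level raising, Camporino–Pacetti Thm A's auxiliary Steinberg set Q) | OPEN | ATTACKABLE (transience lemma = ℓ-adic algebra + Čebotarev, inputs W⁺ 17415 + L∤R 18084 for the approximants + Frobenius genericity of ρ, S-implied) · INSTRUMENTABLE (depth-m eigenform tables: a generic good prime of ρ drops out of the level of the depth-m congruent newforms for m ≫ 0) |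
| U₂ | `UniformLevelControl` (crux r3, declared residual) | WEAKER (kernel `uniform_of_levelFiniteness`; its hypothesis C_pt is the OPEN conclusion of U₁, so U₂ is silent about every merely level-free ρ) | OPEN | ATTACKABLE n ≤ 2 over totally real K (Mazur's principle mod ℓ^m with free weight) · IDEA-NEEDED n ≥ 3 (Ihara / «principe de Mazur en dimension supérieure») and at l₀ > 0 (ShimuraVarietyRealizationBarrier) |

Kernels: `closes` (U₁ → U₂ → U, by name, both binders used) · `levelFiniteness_iff_pieces` (THE EQUIV) · `placewise_of_levelFiniteness`,
`uniform_of_levelFiniteness` (necessity from the target) · `…_of_fernSpread` · `…_of_weak` (from B_w 17414 by name) · `…_of_langlands`,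
`pieces_of_langlands` (from the summit) · `closes_parent` (the parent's deciding theorem with U replaced by U₁, U₂: G → U₁ → U₂ → FERN) ·
`closes_root` (eleven binders → `_root_.Langlands` through `DepthPrimeSplit.closes`).  0 sorry; axioms propext / Classical.choice / Quot.sound only.
§4b types the TRANSIENCE vocabulary (`IsFrobGenericAt`, `IsFrobGenericAE`) used in U₁'s attack plan — node-only, not items.
-/

set_option linter.dupNamespace false
set_option linter.unusedVariables false

namespace Summit.Langlands.Langlands.Theorems.TransientLevel

open scoped NumberField
open Filter Field IsDedekindDomain
open Literature.NumberTheory.GaloisRepresentations Literature.NumberTheory.Automorphic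

/-! ## 1. Vocabulary (structured forms of the target's clauses; names of the gen-20 node kept where the text is the same) -/

section Vocabulary

variable {K : Type} [Field K] [NumberField K] {n : ℕ} {ℓ : ℕ} [Fact ℓ.Prime]

/-- Pinned-geometric (the target's hypothesis VERBATIM): a.e. unramified and de Rham at `v ∣ ℓ` for Fontaine's pinned datum. -/
def IsPinnedGeometric (ρ : FramedGaloisRep K (PadicAlgCl ℓ) n) : Prop :=
  (∀ᶠ v : HeightOneSpectrum (𝓞 K) in cofinite, ρ.IsUnramifiedAt v) ∧
    ∀ (v : HeightOneSpectrum (𝓞 K)) (hv : ((ℓ : ℕ) : 𝓞 K) ∈ v.asIdeal),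
      (Literature.NumberTheory.PAdicHodge.fontainePstAdicCompletion v ℓ hv).IsDeRhamFramed (ρ.toLocal v)

/-- `CloseAt ι π ρ r v` (lens-4-g0 VERBATIM): `π` has a Satake parameter at `v` whose L-normalised arithmetic-Frobenius polynomial is
coefficientwise within ℓ-adic distance `< r` of `charpoly ρ(σ)` for every arithmetic Frobenius `σ` at `v`. -/
def CloseAt {hcpt : isCompact_glFiniteIntegralLevel n K} (ι : PadicAlgCl ℓ ≃+* ℂ) (π : CuspidalAutomorphicRepData n K hcpt)
    (ρ : FramedGaloisRep K (PadicAlgCl ℓ) n) (r : NNReal) (v : HeightOneSpectrum (𝓞 K)) : Prop :=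
  ∃ α : Multiset ℂ, π.1.HasSatakeParamAt v α ∧ ∀ 𝔓 ∈ v.primesAbove, ∀ σ : absoluteGaloisGroup K, IsArithFrobAt (𝓞 K) σ 𝔓 →
    ∀ i : ℕ, Valued.v ((FramedRep.charpoly ρ σ - arithFrobPolyOfSatake ι v.residueCard 1 α).coeff i) < r

/-- H∞ · LEVEL-FREE PRO-AUTOMORPHIC (the target's hypothesis): for EVERY radius `r > 0` some L-algebraic cuspidal `π_r` is `r`-close to
`ρ` at ALMOST ALL places — the exceptional set may depend on `r`. -/
def IsLevelFreeProAutomorphic (hcpt : isCompact_glFiniteIntegralLevel n K) (ι : PadicAlgCl ℓ ≃+* ℂ)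
    (ρ : FramedGaloisRep K (PadicAlgCl ℓ) n) : Prop :=
  ∀ r : NNReal, 0 < r →
    ∃ π : CuspidalAutomorphicRepData n K hcpt, π.1.IsLAlgebraic ∧ ∀ᶠ v : HeightOneSpectrum (𝓞 K) in cofinite, CloseAt ι π ρ r v

/-- C_pt · PLACEWISE BOUNDED-LEVEL PRO-AUTOMORPHIC (the NEW intermediate language of this node): outside ONE finite set `S`, every place
`v` is, for EVERY radius `r > 0`, a good place of SOME `r`-approximant: an L-algebraic cuspidal `π` that is `r`-close to `ρ` AT `v` and at
almost all places.  (The approximant may depend on `(v, r)`; its other bad places are unconstrained.) -/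
def IsPlacewiseProAutomorphic (hcpt : isCompact_glFiniteIntegralLevel n K) (ι : PadicAlgCl ℓ ≃+* ℂ)
    (ρ : FramedGaloisRep K (PadicAlgCl ℓ) n) : Prop :=
  ∃ S : Set (HeightOneSpectrum (𝓞 K)), S.Finite ∧ ∀ v : HeightOneSpectrum (𝓞 K), v ∉ S → ∀ r : NNReal, 0 < r →
    ∃ π : CuspidalAutomorphicRepData n K hcpt, π.1.IsLAlgebraic ∧ CloseAt ι π ρ r v ∧
      ∀ᶠ w : HeightOneSpectrum (𝓞 K) in cofinite, CloseAt ι π ρ r w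

/-- C · PRO-AUTOMORPHIC OF BOUNDED LEVEL (the target's conclusion VERBATIM): ONE finite `S` serves every radius at every `v ∉ S`. -/
def IsProAutomorphic (hcpt : isCompact_glFiniteIntegralLevel n K) (ι : PadicAlgCl ℓ ≃+* ℂ) (ρ : FramedGaloisRep K (PadicAlgCl ℓ) n) :
    Prop :=
  ∃ S : Set (HeightOneSpectrum (𝓞 K)), S.Finite ∧ ∀ r : NNReal, 0 < r →
    ∃ π : CuspidalAutomorphicRepData n K hcpt, π.1.IsLAlgebraic ∧ ∀ v : HeightOneSpectrum (𝓞 K), v ∉ S → CloseAt ι π ρ r v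

/-- Weakly automorphic (B_w's conclusion VERBATIM): exact Satake–Frobenius compatibility a.e. with ONE L-algebraic cuspidal `π`. -/
def IsWeaklyAutomorphic (hcpt : isCompact_glFiniteIntegralLevel n K) (ι : PadicAlgCl ℓ ≃+* ℂ) (ρ : FramedGaloisRep K (PadicAlgCl ℓ) n) :
    Prop :=
  ∃ π : CuspidalAutomorphicRepData n K hcpt, π.1.IsLAlgebraic ∧
    ∀ᶠ v : HeightOneSpectrum (𝓞 K) in cofinite, SatakeFrobCompatibleAt ι π.1 ρ v

end Vocabulary

/-! ## 2. The items (one-line texts = childroute.route.json VERBATIM; generated from the tree text of the target by texts24.py) -/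

/-- U₁ · PLACEWISE LEVEL CONTROL · crux rank 2 (deciding) · WEAKER than U (`placewise_of_levelFiniteness`) · OPEN · ATTACKABLE
(transience of auxiliary level).  The target's binders and hypotheses VERBATIM; conclusion C_pt instead of C. -/
def PlacewiseLevelControl : Prop :=
  ∀ (K : Type) [Field K] [NumberField K] (n : ℕ) (hcpt : Literature.NumberTheory.Automorphic.isCompact_glFiniteIntegralLevel n K), 0 < n → ∀ (ℓ : ℕ) [Fact ℓ.Prime] (ι : PadicAlgCl ℓ ≃+* ℂ) (ρ : Literature.NumberTheory.GaloisRepresentations.FramedGaloisRep K (PadicAlgCl ℓ) n), ρ.toGaloisRep.IsIrreducible → ((∀ᶠ v : IsDedekindDomain.HeightOneSpectrum (NumberField.RingOfIntegers K) in Filter.cofinite, ρ.IsUnramifiedAt v) ∧ ∀ (v : IsDedekindDomain.HeightOneSpectrum (NumberField.RingOfIntegers K)) (hv : ((ℓ : ℕ) : NumberField.RingOfIntegers K) ∈ v.asIdeal), (Literature.NumberTheory.PAdicHodge.fontainePstAdicCompletion v ℓ hv).IsDeRhamFramed (ρ.toLocal v)) → (∀ r : NNReal, 0 < r → ∃ π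 : Literature.NumberTheory.Automorphic.CuspidalAutomorphicRepData n K hcpt, π.1.IsLAlgebraic ∧ ∀ᶠ v : IsDedekindDomain.HeightOneSpectrum (NumberField.RingOfIntegers K) in Filter.cofinite, (∃ α : Multiset ℂ, π.1.HasSatakeParamAt v α ∧ ∀ 𝔓 ∈ v.primesAbove, ∀ σ : Field.absoluteGaloisGroup K, IsArithFrobAt (NumberField.RingOfIntegers K) σ 𝔓 → ∀ i : ℕ, Valued.v ((Literature.NumberTheory.GaloisRepresentations.FramedRep.charpoly ρ σ - Literature.NumberTheory.Automorphic.arithFrobPolyOfSatake ι v.residueCard 1 α).coeff i) < r)) → ∃ S : Set (IsDedekindDomain.HeightOneSpectrum (NumberField.RingOfIntegers K)), S.Finite ∧ ∀ v : IsDedekindDomain.HeightOneSpectrum (NumberField.RingOfIntegers K), v ∉ S → ∀ r : NNReal, 0 < r → ∃ π : Literature.NumberTheory.Automorphic.CuspidalAutomorphicRepData n K hcpt, π.1.IsLAlgebraic ∧ (∃ α : Multiset ℂ, π.1.HasSatakeParamAt v α ∧ ∀ 𝔓 ∈ v.primesAbove, ∀ σ : Field.absoluteGaloisGroup K, IsArithFrobAt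 (NumberField.RingOfIntegers K) σ 𝔓 → ∀ i : ℕ, Valued.v ((Literature.NumberTheory.GaloisRepresentations.FramedRep.charpoly ρ σ - Literature.NumberTheory.Automorphic.arithFrobPolyOfSatake ι v.residueCard 1 α).coeff i) < r) ∧ ∀ᶠ w : IsDedekindDomain.HeightOneSpectrum (NumberField.RingOfIntegers K) in Filter.cofinite, (∃ α : Multiset ℂ, π.1.HasSatakeParamAt w α ∧ ∀ 𝔓 ∈ w.primesAbove, ∀ σ : Field.absoluteGaloisGroup K, IsArithFrobAt (NumberField.RingOfIntegers K) σ 𝔓 → ∀ i : ℕ, Valued.v ((Literature.NumberTheory.GaloisRepresentations.FramedRep.charpoly ρ σ - Literature.NumberTheory.Automorphic.arithFrobPolyOfSatake ι w.residueCard 1 α).coeff i) < r)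

/-- U₂ · UNIFORM LEVEL CONTROL · crux rank 3 (declared residual) · WEAKER than U (`uniform_of_levelFiniteness`) · OPEN ·
ATTACKABLE n ≤ 2 / TR · IDEA-NEEDED n ≥ 3 and l₀ > 0.  The target's text VERBATIM with the hypothesis H∞ REPLACED by C_pt. -/
def UniformLevelControl : Prop :=
  ∀ (K : Type) [Field K] [NumberField K] (n : ℕ) (hcpt : Literature.NumberTheory.Automorphic.isCompact_glFiniteIntegralLevel n K), 0 < n → ∀ (ℓ : ℕ) [Fact ℓ.Prime] (ι : PadicAlgCl ℓ ≃+* ℂ) (ρ : Literature.NumberTheory.GaloisRepresentations.FramedGaloisRep K (PadicAlgCl ℓ) n), ρ.toGaloisRep.IsIrreducible → ((∀ᶠ v : IsDedekindDomain.HeightOneSpectrum (NumberField.RingOfIntegers K) in Filter.cofinite, ρ.IsUnramifiedAt v) ∧ ∀ (v : IsDedekindDomain.HeightOneSpectrum (NumberField.RingOfIntegers K)) (hv : ((ℓ : ℕ) : NumberField.RingOfIntegers K) ∈ v.asIdeal), (Literature.NumberTheory.PAdicHodge.fontainePstAdicCompletion v ℓ hv).IsDeRhamFramed (ρ.toLocal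 v)) → (∃ S : Set (IsDedekindDomain.HeightOneSpectrum (NumberField.RingOfIntegers K)), S.Finite ∧ ∀ v : IsDedekindDomain.HeightOneSpectrum (NumberField.RingOfIntegers K), v ∉ S → ∀ r : NNReal, 0 < r → ∃ π : Literature.NumberTheory.Automorphic.CuspidalAutomorphicRepData n K hcpt, π.1.IsLAlgebraic ∧ (∃ α : Multiset ℂ, π.1.HasSatakeParamAt v α ∧ ∀ 𝔓 ∈ v.primesAbove, ∀ σ : Field.absoluteGaloisGroup K, IsArithFrobAt (NumberField.RingOfIntegers K) σ 𝔓 → ∀ i : ℕ, Valued.v ((Literature.NumberTheory.GaloisRepresentations.FramedRep.charpoly ρ σ - Literature.NumberTheory.Automorphic.arithFrobPolyOfSatake ι v.residueCard 1 α).coeff i) < r) ∧ ∀ᶠ w : IsDedekindDomain.HeightOneSpectrum (NumberField.RingOfIntegers K) in Filter.cofinite, (∃ α : Multiset ℂ, π.1.HasSatakeParamAt w α ∧ ∀ 𝔓 ∈ w.primesAbove, ∀ σ : Field.absoluteGaloisGroup K, IsArithFrobAt (NumberField.RingOfIntegers K) σ 𝔓 → ∀ i : ℕ, Valued.v ((Literature.NumberTheory.GaloisRepresentations.FramedRep.charpoly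 ρ σ - Literature.NumberTheory.Automorphic.arithFrobPolyOfSatake ι w.residueCard 1 α).coeff i) < r)) → ∃ S : Set (IsDedekindDomain.HeightOneSpectrum (NumberField.RingOfIntegers K)), S.Finite ∧ ∀ r : NNReal, 0 < r → ∃ π : Literature.NumberTheory.Automorphic.CuspidalAutomorphicRepData n K hcpt, π.1.IsLAlgebraic ∧ ∀ v : IsDedekindDomain.HeightOneSpectrum (NumberField.RingOfIntegers K), v ∉ S → (∃ α : Multiset ℂ, π.1.HasSatakeParamAt v α ∧ ∀ 𝔓 ∈ v.primesAbove, ∀ σ : Field.absoluteGaloisGroup K, IsArithFrobAt (NumberField.RingOfIntegers K) σ 𝔓 → ∀ i : ℕ, Valued.v ((Literature.NumberTheory.GaloisRepresentations.FramedRep.charpoly ρ σ - Literature.NumberTheory.Automorphic.arithFrobPolyOfSatake ι v.residueCard 1 α).coeff i) < r)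

/-- ChildAssembly (curried deciding theorem, the node's `Assembly`; renamed in this census twin because a helper may not declare a registry-owned name): U₁ → U₂ → U. -/
def ChildAssembly : Prop :=
  PlacewiseLevelControl → UniformLevelControl → Summit.Langlands.Langlands.Theses.AuxiliaryLevelSplit.LevelFiniteness

/-! ## 3. Structured readings (all `Iff.rfl`: the one-liners ARE the structured statements) -/

/-- U₁ unfolded to the structured vocabulary (level-free pro-automorphic ⇒ placewise pro-automorphic). -/
theorem placewiseLevelControl_iff : PlacewiseLevelControl ↔
    ∀ (K : Type) [Field K] [NumberField K] (n : ℕ) (hcpt : isCompact_glFiniteIntegralLevel n K), 0 < n →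
      ∀ (ℓ : ℕ) [Fact ℓ.Prime] (ι : PadicAlgCl ℓ ≃+* ℂ) (ρ : FramedGaloisRep K (PadicAlgCl ℓ) n),
        ρ.toGaloisRep.IsIrreducible → IsPinnedGeometric ρ →
        IsLevelFreeProAutomorphic hcpt ι ρ → IsPlacewiseProAutomorphic hcpt ι ρ :=
  Iff.rfl

/-- U₂ unfolded to the structured vocabulary (placewise pro-automorphic ⇒ pro-automorphic of bounded level). -/
theorem uniformLevelControl_iff : UniformLevelControl ↔
    ∀ (K : Type) [Field K] [NumberField K] (n : ℕ) (hcpt : isCompact_glFiniteIntegralLevel n K), 0 < n →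
      ∀ (ℓ : ℕ) [Fact ℓ.Prime] (ι : PadicAlgCl ℓ ≃+* ℂ) (ρ : FramedGaloisRep K (PadicAlgCl ℓ) n),
        ρ.toGaloisRep.IsIrreducible → IsPinnedGeometric ρ →
        IsPlacewiseProAutomorphic hcpt ι ρ → IsProAutomorphic hcpt ι ρ :=
  Iff.rfl

/-- the target U unfolded to the structured vocabulary. -/
theorem levelFiniteness_iff_structured : Summit.Langlands.Langlands.Theses.AuxiliaryLevelSplit.LevelFiniteness ↔
    ∀ (K : Type) [Field K] [NumberField K] (n : ℕ) (hcpt : isCompact_glFiniteIntegralLevel n K), 0 < n →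
      ∀ (ℓ : ℕ) [Fact ℓ.Prime] (ι : PadicAlgCl ℓ ≃+* ℂ) (ρ : FramedGaloisRep K (PadicAlgCl ℓ) n),
        ρ.toGaloisRep.IsIrreducible → IsPinnedGeometric ρ →
        IsLevelFreeProAutomorphic hcpt ι ρ → IsProAutomorphic hcpt ι ρ :=
  Iff.rfl

/-- the grandparent FERN unfolded to the structured vocabulary. -/
theorem fernSpread_iff_structured : Summit.Langlands.Langlands.Theses.DepthPrimeSplit.FernSpread ↔
    ∀ (K : Type) [Field K] [NumberField K] (n : ℕ) (hcpt : isCompact_glFiniteIntegralLevel n K), 0 < n →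
      ∀ (ℓ : ℕ) [Fact ℓ.Prime] (ι : PadicAlgCl ℓ ≃+* ℂ) (ρ : FramedGaloisRep K (PadicAlgCl ℓ) n),
        ρ.toGaloisRep.IsIrreducible → IsPinnedGeometric ρ →
        (∃ π : CuspidalAutomorphicRepData n K hcpt, π.1.IsLAlgebraic ∧ ∀ᶠ v : HeightOneSpectrum (𝓞 K) in cofinite, CloseAt ι π ρ 1 v) →
        IsProAutomorphic hcpt ι ρ :=
  Iff.rfl

/-- B_w unfolded to the structured vocabulary. -/
theorem weak_iff_structured : Summit.Langlands.Langlands.Theses.PrimeSwitchSplit.WeakGeometricAutomorphy ↔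
    ∀ (K : Type) [Field K] [NumberField K] (n : ℕ) (hcpt : isCompact_glFiniteIntegralLevel n K), 0 < n →
      ∀ (ℓ : ℕ) [Fact ℓ.Prime] (ι : PadicAlgCl ℓ ≃+* ℂ) (ρ : FramedGaloisRep K (PadicAlgCl ℓ) n),
        ρ.toGaloisRep.IsIrreducible → IsPinnedGeometric ρ → IsWeaklyAutomorphic hcpt ι ρ :=
  Iff.rfl

/-! ## 4. Kernel lemmas on the ladder of depths  H∞ ⟸ C_pt ⟸ C ⟸ (weak automorphy) -/

section Kernel

variable {K : Type} [Field K] [NumberField K] {n : ℕ} {hcpt : isCompact_glFiniteIntegralLevel n K} {ℓ : ℕ} [Fact ℓ.Prime]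
  {ι : PadicAlgCl ℓ ≃+* ℂ} {π : CuspidalAutomorphicRepData n K hcpt} {ρ : FramedGaloisRep K (PadicAlgCl ℓ) n}
  {v : HeightOneSpectrum (𝓞 K)}

/-- Exact Satake–Frobenius compatibility is closeness at every positive radius (the difference is `0`). -/
theorem closeAt_of_compatible (h : SatakeFrobCompatibleAt ι π.1 ρ v) {r : NNReal} (hr : 0 < r) : CloseAt ι π ρ r v := by
  obtain ⟨α, hα, _hur, hP⟩ := h
  refine ⟨α, hα, fun 𝔓 h𝔓 σ hσ i => ?_⟩
  have hc : FramedRep.charpoly ρ σ = arithFrobPolyOfSatake ι v.residueCard 1 α := hP 𝔓 h𝔓 σ hσ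
  rw [hc, sub_self, Polynomial.coeff_zero, map_zero]
  exact hr

/-- C ⇒ C_pt: one finite `S` good for every radius is a fortiori good placewise (and a.e.). -/
theorem placewise_of_pro (h : IsProAutomorphic hcpt ι ρ) : IsPlacewiseProAutomorphic hcpt ι ρ := by
  obtain ⟨S, hS, h⟩ := h
  refine ⟨S, hS, fun v hv r hr => ?_⟩
  obtain ⟨π, hπ, hclose⟩ := h r hr
  refine ⟨π, hπ, hclose v hv, Filter.eventually_cofinite.mpr (hS.subset fun w hw => ?_)⟩
  by_contra hwS
  exact hw (hclose w hwS)

/-- C_pt ⇒ H∞: a number field has infinitely many finite places, so some `v ∉ S` exists; its `r`-approximant is `r`-close a.e. -/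
theorem levelFree_of_placewise (h : IsPlacewiseProAutomorphic hcpt ι ρ) : IsLevelFreeProAutomorphic hcpt ι ρ := by
  obtain ⟨S, hS, h⟩ := h
  haveI : Infinite (HeightOneSpectrum (𝓞 K)) := Literature.NumberTheory.Automorphic.infinite_heightOneSpectrum K
  obtain ⟨v, hv⟩ := Set.Finite.exists_notMem hS
  intro r hr
  obtain ⟨π, hπ, _hv, hae⟩ := h v hv r hr
  exact ⟨π, hπ, hae⟩

/-- C ⇒ H∞ (the gen-20 node's `levelFree_of_pro`, now a composite through C_pt). -/
theorem levelFree_of_pro (h : IsProAutomorphic hcpt ι ρ) : IsLevelFreeProAutomorphic hcpt ι ρ :=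
  levelFree_of_placewise (placewise_of_pro h)

/-- weak automorphy ⇒ C with `S` = the (finite) exceptional set of the one `π` (gen-20 `pro_of_weakly`). -/
theorem pro_of_weakly (h : IsWeaklyAutomorphic hcpt ι ρ) : IsProAutomorphic hcpt ι ρ := by
  obtain ⟨π, hπ, hcof⟩ := h
  refine ⟨{v | ¬ SatakeFrobCompatibleAt ι π.1 ρ v}, Filter.eventually_cofinite.mp hcof, fun r hr => ?_⟩
  refine ⟨π, hπ, fun v hv => closeAt_of_compatible ?_ hr⟩
  by_contra hc
  exact hv hc

/-- a weakly automorphic ρ is placewise pro-automorphic (constant approximating family). -/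
theorem placewise_of_weakly (h : IsWeaklyAutomorphic hcpt ι ρ) : IsPlacewiseProAutomorphic hcpt ι ρ :=
  placewise_of_pro (pro_of_weakly h)

end Kernel

/-! ## 4b. TRANSIENCE vocabulary (node-only; the objects of U₁'s attack plan — not items) -/

section Transience

variable {K : Type} [Field K] [NumberField K] {n : ℕ} {ℓ : ℕ} [Fact ℓ.Prime]

/-- FROBENIUS GENERICITY of `ρ` at `v`: no two roots of `charpoly ρ(σ)` (σ an arithmetic Frobenius at a prime over `v`) are in ratio
`q_v = #k(v)` — the ℓ-adic shadow of «the unramified local component is a full irreducible induced (generic) representation»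
(Bernstein–Zelevinsky: `Ind(χ₁,…,χ_n)` irreducible iff `χ_i χ_j⁻¹ ≠ |·|^{±1}`).  It is the OPEN-AND-CLOSED condition on the limit `ρ|_{Γ_v}`
under which a depth-`m` level-raising congruence at `v` cannot persist (U₁'s transience lemma), and the complement of the witness family
of `Literature.Barriers.Langlands.MonodromyNotClosedUnderPadicLimits` (there the limit `ρ₀₀ ⊕ ρ₁₁` has eigenvalue ratio exactly `q_v`). -/
def IsFrobGenericAt (ρ : FramedGaloisRep K (PadicAlgCl ℓ) n) (v : HeightOneSpectrum (𝓞 K)) : Prop :=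
  ∀ 𝔓 ∈ v.primesAbove, ∀ σ : absoluteGaloisGroup K, IsArithFrobAt (𝓞 K) σ 𝔓 →
    ∀ a b : PadicAlgCl ℓ, (FramedRep.charpoly ρ σ).IsRoot a → (FramedRep.charpoly ρ σ).IsRoot b →
      a ≠ (v.residueCard : PadicAlgCl ℓ) * b

/-- GENERICITY ALMOST EVERYWHERE (the input of U₁'s attack; S-implied in print via Shalika genericity + Bernstein–Zelevinsky + Satake–Frobenius
compatibility; known unconditionally for PURE ρ, e.g. ρ cut out of the cohomology of a smooth projective variety, by Deligne's Weil II). -/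
def IsFrobGenericAE (ρ : FramedGaloisRep K (PadicAlgCl ℓ) n) : Prop :=
  ∀ᶠ v : HeightOneSpectrum (𝓞 K) in cofinite, IsFrobGenericAt ρ v

/-- The finite exceptional set that U₁'s attack proposes for C_pt: the non-generic places (finite under `IsFrobGenericAE`). -/
theorem finite_nonGeneric {ρ : FramedGaloisRep K (PadicAlgCl ℓ) n} (h : IsFrobGenericAE ρ) :
    {v : HeightOneSpectrum (𝓞 K) | ¬ IsFrobGenericAt ρ v}.Finite :=
  Filter.eventually_cofinite.mp h

end Transience

/-! ## 5. The node: deciding theorem, necessity from the target, THE ONE EQUIV -/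

/-- DECIDING THEOREM of the node / child route (D-0027 §2.1): U₁ → U₂ → U, concluding the target BY NAME; both binders used. -/
theorem closes_target (h₁ : PlacewiseLevelControl) (h₂ : UniformLevelControl) :
    Summit.Langlands.Langlands.Theses.AuxiliaryLevelSplit.LevelFiniteness := by
  intro K _ _ n hcpt hn ℓ _ ι ρ hirr hgeo hinf
  exact h₂ K n hcpt hn ℓ ι ρ hirr hgeo (h₁ K n hcpt hn ℓ ι ρ hirr hgeo hinf)

/-- `ChildAssembly` holds (it is `closes_target`). -/
theorem childAssembly_proof : ChildAssembly := fun h₁ h₂ => closes_target h₁ h₂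

/-- NECESSITY: U ⇒ U₁ (bounded level is a fortiori placewise: C ⇒ C_pt). -/
theorem placewise_of_levelFiniteness (hU : Summit.Langlands.Langlands.Theses.AuxiliaryLevelSplit.LevelFiniteness) :
    PlacewiseLevelControl := by
  intro K _ _ n hcpt hn ℓ _ ι ρ hirr hgeo hinf
  exact placewise_of_pro (hU K n hcpt hn ℓ ι ρ hirr hgeo hinf)

/-- NECESSITY: U ⇒ U₂ (C_pt ⇒ H∞, then U). -/
theorem uniform_of_levelFiniteness (hU : Summit.Langlands.Langlands.Theses.AuxiliaryLevelSplit.LevelFiniteness) :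
    UniformLevelControl := by
  intro K _ _ n hcpt hn ℓ _ ι ρ hirr hgeo hpt
  exact hU K n hcpt hn ℓ ι ρ hirr hgeo (levelFree_of_placewise hpt)

/-- THE ONE EQUIV of the node (lens-3): U ⟺ U₁ ∧ U₂, modulo NOTHING. -/
theorem levelFiniteness_iff_pieces :
    Summit.Langlands.Langlands.Theses.AuxiliaryLevelSplit.LevelFiniteness ↔ PlacewiseLevelControl ∧ UniformLevelControl :=
  ⟨fun h => ⟨placewise_of_levelFiniteness h, uniform_of_levelFiniteness h⟩, fun h => closes_target h.1 h.2⟩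

/-! ## 6. Necessity from FERN (25024), from B_w (17414, by name) and from the summit -/

/-- FERN ⇒ U (gen-20 `levelFiniteness_of_fernSpread`, re-proved here: H∞ at radius 1 is FERN's hypothesis H1). -/
theorem levelFiniteness_of_fernSpread (hF : Summit.Langlands.Langlands.Theses.DepthPrimeSplit.FernSpread) :
    Summit.Langlands.Langlands.Theses.AuxiliaryLevelSplit.LevelFiniteness := by
  intro K _ _ n hcpt hn ℓ _ ι ρ hirr hgeo hinf
  exact hF K n hcpt hn ℓ ι ρ hirr hgeo (hinf 1 one_pos)

/-- U₁ is FERN-implied. -/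
theorem placewiseLevelControl_of_fernSpread (hF : Summit.Langlands.Langlands.Theses.DepthPrimeSplit.FernSpread) : PlacewiseLevelControl :=
  placewise_of_levelFiniteness (levelFiniteness_of_fernSpread hF)

/-- U₂ is FERN-implied. -/
theorem uniformLevelControl_of_fernSpread (hF : Summit.Langlands.Langlands.Theses.DepthPrimeSplit.FernSpread) : UniformLevelControl :=
  uniform_of_levelFiniteness (levelFiniteness_of_fernSpread hF)

/-- U₁ is B_w-implied. -/
theorem placewiseLevelControl_of_weak (hB : Summit.Langlands.Langlands.Theses.PrimeSwitchSplit.WeakGeometricAutomorphy) :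
    PlacewiseLevelControl := by
  intro K _ _ n hcpt hn ℓ _ ι ρ hirr hgeo _hinf
  exact placewise_of_weakly (hB K n hcpt hn ℓ ι ρ hirr hgeo)

/-- U₂ is B_w-implied. -/
theorem uniformLevelControl_of_weak (hB : Summit.Langlands.Langlands.Theses.PrimeSwitchSplit.WeakGeometricAutomorphy) :
    UniformLevelControl := by
  intro K _ _ n hcpt hn ℓ _ ι ρ hirr hgeo _hpt
  exact pro_of_weakly (hB K n hcpt hn ℓ ι ρ hirr hgeo)

/-- `Langlands ⟹ B_w` (projection of direction (B); `Rec.pst` is Fontaine's pinned datum by `rfl`) — lens-4-g0's proof. -/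
private theorem weakGeometricAutomorphy_of_langlands (hL : _root_.Langlands) :
    Summit.Langlands.Langlands.Theses.PrimeSwitchSplit.WeakGeometricAutomorphy := by
  intro K _ _ n hcpt hn ℓ _ ι ρ hirr hgeo
  obtain ⟨⟨Rec⟩, h⟩ := hL K
  obtain ⟨π, hπ, hcorr⟩ := (h Rec n hn hcpt).2 ℓ ι ρ hirr ⟨hgeo.1, fun v hv => hgeo.2 v hv⟩
  exact ⟨π, hπ, hcorr.1⟩

/-- U₁ is implied by the summit. -/
theorem placewiseLevelControl_of_langlands (hL : _root_.Langlands) : PlacewiseLevelControl :=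
  placewiseLevelControl_of_weak (weakGeometricAutomorphy_of_langlands hL)

/-- U₂ is implied by the summit. -/
theorem uniformLevelControl_of_langlands (hL : _root_.Langlands) : UniformLevelControl :=
  uniformLevelControl_of_weak (weakGeometricAutomorphy_of_langlands hL)

/-- ROOT-IMPLIED certificate for the whole node: the summit implies both pieces (no EXCESS). -/
theorem pieces_of_langlands (hL : _root_.Langlands) : PlacewiseLevelControl ∧ UniformLevelControl :=
  ⟨placewiseLevelControl_of_langlands hL, uniformLevelControl_of_langlands hL⟩

/-! ## 7. The frames: the parent's and the grandparent's deciding theorems with U replaced by U₁, U₂ -/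

/-- Parent frame: G → U₁ → U₂ → FERN through `AuxiliaryLevelSplit.closes`. -/
theorem closes_parent (hG : Summit.Langlands.Langlands.Theses.AuxiliaryLevelSplit.LevelFreeFern) (h₁ : PlacewiseLevelControl)
    (h₂ : UniformLevelControl) : Summit.Langlands.Langlands.Theses.DepthPrimeSplit.FernSpread :=
  Summit.Langlands.Langlands.Theses.AuxiliaryLevelSplit.closes hG (closes_target h₁ h₂)

/-- Root frame: the grandparent's deciding theorem with FERN replaced by G, U₁, U₂ (ten binders → the summit). -/
theorem closes_root (hD : Summit.Langlands.Langlands.Theses.DepthPrimeSplit.DyadicSeed) (hO : Summit.Langlands.Langlands.Theses.DepthPrimeSplit.OddPrimeSeed)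
    (hG : Summit.Langlands.Langlands.Theses.AuxiliaryLevelSplit.LevelFreeFern) (h₁ : PlacewiseLevelControl) (h₂ : UniformLevelControl)
    (hC : Summit.Langlands.Langlands.Theses.DepthPrimeSplit.Classicality) (hW : Summit.Langlands.Langlands.Theses.DepthPrimeSplit.SatakeAvatarExistence)
    (hP : Summit.Langlands.Langlands.Theses.DepthPrimeSplit.PadicMemberCompatibility)
    (hA : Summit.Langlands.Langlands.Theses.DepthPrimeSplit.CompatibilityAwayFromLR) (hR : Summit.Langlands.Langlands.Theses.DepthPrimeSplit.CanonicalReciprocityData) :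
    _root_.Langlands :=
  Summit.Langlands.Langlands.Theses.DepthPrimeSplit.closes hD hO (closes_parent hG h₁ h₂) hC hW hP hA hR


end Summit.Langlands.Langlands.Theorems.TransientLevel
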